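import Summits.QuantumFields.BalabanUV.Beta.GAN24.T2SlotUnits

/-!
# `BalabanUV.Beta.GAN24.T2SlotCovariance` — binder row G-an2-4 / (CONV-C), W-slot road «W3» (SKELETON-W3 v1.0 §8.3/§8.5):
# JOINT BLOCK COVARIANCE OF THE NORMALISED STAGE-B BI-STENCIL FAMILY `T♮_j` AND OF ITS DIFFERENCES — the `hcov` slot of the
# irrelevant transport row (T-irr) in leaf-19's `T2SlotUnits` currency

NOT IN PRINT; OUR BOOKKEEPING (G-an2-4 formalisation swarm, leaf prover `b2b-balaban-gan24-formalise-leaf-19`, gen 19; journal INTENT «T2-COV*»;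
a one-shot adapter, NOT a row of SKELETON-W3; module name PROVISIONAL — the row owner gan24-p1 may rename / re-home it).  HONEST FRAMING (cell
contract, verbatim): «discharging `BetaPertH` makes Bałaban's UV stability UNCONDITIONAL — a real constructive-QFT result; it is NOT the continuum
limit and NOT the Clay problem.»  HONEST DEPENDENCY (verbatim): «continuum YM on T⁴ ⇐ BetaPertH ∧ nine spine estimates (0/9 proved); BetaPertH ⇐
(D1) ∧ (D4) ∧ CAP+tail; G-an2-4 gates asym, D1 and NE2/3/4.»

WHY.  The irrelevant transport core of road «W3» (leaf-12's (T-irr) core-b: `Push4Slices.sliceSum_add_zsmul`, `LatticeFreeze`, `EnvelopeBlockSum`)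
carries, next to the vanishing field–field zero mode `Z_ff X = 0` (leaf-02's `BiStencilZeroMode.zmode`), the JOINT BLOCK COVARIANCE of the transported
table, `hcov : ∀ κ u κ′ u′ t, X κ (u + Lc•t) κ′ (u′ + Lc•t) = shiftK (−Lc•t) (X κ u κ′ u′)` (the hypothesis shape of leaf-02's `inner_periodic` and the
conclusion shape of an2's `BalabanStepW2.T2Of_translate`): it makes the slice charge `Lc`-periodic, so that `zmode = 0` kills the order-0 term of the
Taylor expansion against the block-smooth composite legs.  The tables the W3 ENDs (`WSlotT2OfPieces`, p211117) transport are the NORMALISED members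
`T♮_j := unitS₂ (sfStep Lc j) (smStep d Lc j) (T2Of d Lc cE cVH cΛ cE₂ cB Tc (vh₂S d Lc) mixFF j)` (leaf-19's `T2SlotUnits` currency), their one-step
differences `D n := T♮_{n+1} − T♮_n` (ROW W3-F4d's `D 0`; END #2's tower) and the sources∕forcings built from them.  This file supplies the
covariance of `T♮_j`, `D n` and `T♮_{k+j} − T♮_k` BY NAME, whichever way the owner places the covariance slot (inside the `Zfree` parameter or as
an explicit binder of `hTirr`).

WHAT ([folklore] `funext`-level bookkeeping + ONE instantiation of an2's covariance theorem; generic `d`; 0 `def`, 0 cite, 0 sorry):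
* §1 TWO-SHIFT COVARIANCE IS PRESERVED BY THE UNIT BOOKKEEPING — for ANY bond shift `w` and kernel shift `v` (so both leaf-16's all-unit-translations
  shape `(t, −t)` of `TransversalZeroMode` §4 and the joint block shape `(Lc•t, −Lc•t)` are instances): `unitS₂_translate` (leaf-19's `unitS₂_apply` is
  an entrywise fibre re-weighting), `smul_translate`, `add_translate`, `sub_translate` (the END's difference LAMBDA `fun κ u κ′ u′ ↦ A κ u κ′ u′ − B κ u κ′ u′`),
  `sum_translate` (finite sums, the shape of (F1)'s unrolled recursion).
* §2 THE NORMALISED STAGE-B FAMILY: **`unitS₂_T2Of_translate`** — every `T♮_j` is jointly `Lc`-covariant (an2's `T2Of_translate` BY NAME; its border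
  binder `hBt` DISCHARGED by an1's tree theorem `AveragingMixedJetTables.vh₂S_translate`; the mixed-table covariance `hmixt` — the hypothesis shape of
  `T2Of_translate` — stays the ONE binder, next to the mixed-table shape binder `hmix` of ROWS-MIX); **`T2diff_translate`** (every one-step difference
  `D n`, in the END's lambda form — at `n = 0` the `hcov` of ROW W3-F4d's `D 0`); **`T2cauchy_translate`** (every `T♮_{k+j} − T♮_k`).
Asserts NO shape or rate of Bałaban's tables; discharges NOTHING of «T2Shape» ∕ «T2SupRate» ∕ (hW, hWall); 0 wall binders instantiated; NOT
«W-slot closed», NEVER «G-an2-4 closed»; NOT BetaPertH, NOT continuum, NOT Clay.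
-/

noncomputable section

open Finset
open scoped BigOperators
open Literature.MathematicalPhysics.QuantumFieldTheory
open Literature.MathematicalPhysics.QuantumFieldTheory.Balaban1983to89
open Literature.MathematicalPhysics.QuantumFieldTheory.Balaban1983to89.Beta
open ExpKernelCalculus (MKer shiftK)
open OneStepResolventKernel (Fib)
open BalabanStepW2 (T2Of T2Of_translate)
open AveragingMixedJetTables (vh₂S vh₂S_translate)
open Summit.QuantumFields.BalabanUV.Beta.SecondOrderUnits (unitS₂)
open Summit.QuantumFields.BalabanUV.Beta.GAN24.CombesThomas (sfStep smStep)
open Summit.QuantumFields.BalabanUV.Beta.GAN24.T2SlotUnits (unitS₂_apply)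

namespace Summit.QuantumFields.BalabanUV.Beta.GAN24.T2SlotCovariance

variable {d : ℕ}

/-! ## §1 Two-shift covariance survives the unit bookkeeping and the linear table operations -/

section Generic

variable {A B : Fin (d + 1) → (Fin (d + 1) → ℤ) → Fin (d + 1) → (Fin (d + 1) → ℤ) → MKer (d + 1) (Fib d)}
  {w v : Fin (d + 1) → ℤ}

/-- [folklore] **`unitS₂` COMMUTES WITH JOINT TRANSLATIONS** (any bond shift `w`, any kernel shift `v`): if
`A κ (u + w) κ′ (u′ + w) = shiftK v (A κ u κ′ u′)` for all bond labels, then the same holds for `unitS₂ s_f s_m A` — the change of units is an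
entrywise fibre re-weighting (leaf-19's `unitS₂_apply`). -/
theorem unitS₂_translate (sf sm : ℝ)
    (hA : ∀ (κ : Fin (d + 1)) (u : Fin (d + 1) → ℤ) (κ' : Fin (d + 1)) (u' : Fin (d + 1) → ℤ),
      A κ (u + w) κ' (u' + w) = shiftK v (A κ u κ' u'))
    (κ : Fin (d + 1)) (u : Fin (d + 1) → ℤ) (κ' : Fin (d + 1)) (u' : Fin (d + 1) → ℤ) :
    unitS₂ sf sm A κ (u + w) κ' (u' + w) = shiftK v (unitS₂ sf sm A κ u κ' u') := by
  funext x z a b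
  simp only [shiftK, unitS₂_apply, hA κ u κ' u']

/-- [folklore] Scalar multiples (entrywise, the END's lambda form) keep two-shift covariance. -/
theorem smul_translate (c : ℝ)
    (hA : ∀ (κ : Fin (d + 1)) (u : Fin (d + 1) → ℤ) (κ' : Fin (d + 1)) (u' : Fin (d + 1) → ℤ),
      A κ (u + w) κ' (u' + w) = shiftK v (A κ u κ' u'))
    (κ : Fin (d + 1)) (u : Fin (d + 1) → ℤ) (κ' : Fin (d + 1)) (u' : Fin (d + 1) → ℤ) :
    (fun κ u κ' u' => c • A κ u κ' u') κ (u + w) κ' (u' + w) = shiftK v ((fun κ u κ' u' => c • A κ u κ' u') κ u κ' u') := by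
  funext x z a b
  simp only [shiftK, Pi.smul_apply, smul_eq_mul, hA κ u κ' u']

/-- [folklore] Sums (the END's lambda form) keep two-shift covariance. -/
theorem add_translate
    (hA : ∀ (κ : Fin (d + 1)) (u : Fin (d + 1) → ℤ) (κ' : Fin (d + 1)) (u' : Fin (d + 1) → ℤ),
      A κ (u + w) κ' (u' + w) = shiftK v (A κ u κ' u'))
    (hB : ∀ (κ : Fin (d + 1)) (u : Fin (d + 1) → ℤ) (κ' : Fin (d + 1)) (u' : Fin (d + 1) → ℤ),
      B κ (u + w) κ' (u' + w) = shiftK v (B κ u κ' u'))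
    (κ : Fin (d + 1)) (u : Fin (d + 1) → ℤ) (κ' : Fin (d + 1)) (u' : Fin (d + 1) → ℤ) :
    (fun κ u κ' u' => A κ u κ' u' + B κ u κ' u') κ (u + w) κ' (u' + w)
      = shiftK v ((fun κ u κ' u' => A κ u κ' u' + B κ u κ' u') κ u κ' u') := by
  funext x z a b
  simp only [shiftK, Pi.add_apply, hA κ u κ' u', hB κ u κ' u']

/-- [folklore] **DIFFERENCES keep two-shift covariance** — in the lambda form `fun κ u κ′ u′ ↦ A κ u κ′ u′ − B κ u κ′ u′` the W3 ENDs write the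
one-step differences `D n` and ROW W3-F4d writes `D 0` in. -/
theorem sub_translate
    (hA : ∀ (κ : Fin (d + 1)) (u : Fin (d + 1) → ℤ) (κ' : Fin (d + 1)) (u' : Fin (d + 1) → ℤ),
      A κ (u + w) κ' (u' + w) = shiftK v (A κ u κ' u'))
    (hB : ∀ (κ : Fin (d + 1)) (u : Fin (d + 1) → ℤ) (κ' : Fin (d + 1)) (u' : Fin (d + 1) → ℤ),
      B κ (u + w) κ' (u' + w) = shiftK v (B κ u κ' u'))
    (κ : Fin (d + 1)) (u : Fin (d + 1) → ℤ) (κ' : Fin (d + 1)) (u' : Fin (d + 1) → ℤ) :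
    (fun κ u κ' u' => A κ u κ' u' - B κ u κ' u') κ (u + w) κ' (u' + w)
      = shiftK v ((fun κ u κ' u' => A κ u κ' u' - B κ u κ' u') κ u κ' u') := by
  funext x z a b
  simp only [shiftK, Pi.sub_apply, hA κ u κ' u', hB κ u κ' u']

/-- [folklore] **FINITE SUMS keep two-shift covariance** (the shape of (F1)'s unrolled affine recursion `Σ_{i ∈ s} P … (b i)`). -/
theorem sum_translate {ι : Type*} (s : Finset ι)
    (F : ι → Fin (d + 1) → (Fin (d + 1) → ℤ) → Fin (d + 1) → (Fin (d + 1) → ℤ) → MKer (d + 1) (Fib d))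
    (hF : ∀ i ∈ s, ∀ (κ : Fin (d + 1)) (u : Fin (d + 1) → ℤ) (κ' : Fin (d + 1)) (u' : Fin (d + 1) → ℤ),
      F i κ (u + w) κ' (u' + w) = shiftK v (F i κ u κ' u'))
    (κ : Fin (d + 1)) (u : Fin (d + 1) → ℤ) (κ' : Fin (d + 1)) (u' : Fin (d + 1) → ℤ) :
    (∑ i ∈ s, F i) κ (u + w) κ' (u' + w) = shiftK v ((∑ i ∈ s, F i) κ u κ' u') := by
  funext x z a b
  simp only [shiftK, Finset.sum_apply]
  exact Finset.sum_congr rfl fun i hi => by rw [hF i hi κ u κ' u']; rfl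

end Generic

/-! ## §2 The normalised Stage-B family and its differences are jointly `Lc`-covariant -/

section StageB

variable {Lc : ℕ} [NeZero Lc]

/-- **JOINT BLOCK COVARIANCE OF THE NORMALISED STAGE-B FAMILY** [folklore instantiation]: for every member `j`,
`T♮_j κ (u + Lc•t) κ′ (u′ + Lc•t) = shiftK (−Lc•t) (T♮_j κ u κ′ u′)`, where
`T♮_j := unitS₂ (sfStep Lc j) (smStep d Lc j) (T2Of d Lc cE cVH cΛ cE₂ cB Tc (vh₂S d Lc) mixFF j)` — an2's `BalabanStepW2.T2Of_translate` (its border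
binder discharged by an1's `AveragingMixedJetTables.vh₂S_translate`; the mixed-table covariance `hmixt` is its own hypothesis shape, kept as the one
binder) transported through §1 `unitS₂_translate`.  This is the `hcov` text of the (T-irr) core-b for `X := T♮_j`. -/
theorem unitS₂_T2Of_translate (hLc : 1 ≤ Lc) (cE cVH cΛ cE₂ cB : ℝ) (Tc : Fin 4 → Fin 4 → Fin 4 → Fin 4 → ℝ)
    {mixFF : Fin (d + 1) → (Fin (d + 1) → ℤ) → Fin (d + 1) → (Fin (d + 1) → ℤ) → MKer (d + 1) (Fib d)}
    (hmixt : ∀ (κ : Fin (d + 1)) (u : Fin (d + 1) → ℤ) (ρ : Fin (d + 1)) (w t : Fin (d + 1) → ℤ),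
      mixFF κ (u + (Lc : ℤ) • t) ρ (w + t) = shiftK (-((Lc : ℤ) • t)) (mixFF κ u ρ w))
    (j : ℕ) (κ : Fin (d + 1)) (u : Fin (d + 1) → ℤ) (κ' : Fin (d + 1)) (u' t : Fin (d + 1) → ℤ) :
    unitS₂ (sfStep Lc j) (smStep d Lc j) (T2Of d Lc cE cVH cΛ cE₂ cB Tc (vh₂S d Lc) mixFF j) κ (u + (Lc : ℤ) • t) κ' (u' + (Lc : ℤ) • t)
      = shiftK (-((Lc : ℤ) • t))
          (unitS₂ (sfStep Lc j) (smStep d Lc j) (T2Of d Lc cE cVH cΛ cE₂ cB Tc (vh₂S d Lc) mixFF j) κ u κ' u') :=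
  unitS₂_translate (w := (Lc : ℤ) • t) (v := -((Lc : ℤ) • t)) (sfStep Lc j) (smStep d Lc j)
    (fun κ u κ' u' => T2Of_translate hLc cE cVH cΛ cE₂ cB Tc (fun κ u κ' u' t => vh₂S_translate hLc κ u κ' u' t) hmixt j κ u κ' u' t)
    κ u κ' u'

/-- **JOINT BLOCK COVARIANCE OF THE ONE-STEP DIFFERENCES `D n = T♮_{n+1} − T♮_n`** [folklore], in the END's lambda form — at `n = 0` LITERALLY the
`hcov` of ROW W3-F4d's first difference `D 0` (leaf-07's `WSlotFirstDiff` ∕ `WSlotT2OfPieces.t2Drift_of_rows`' `h0`, `hZ0` table). -/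
theorem T2diff_translate (hLc : 1 ≤ Lc) (cE cVH cΛ cE₂ cB : ℝ) (Tc : Fin 4 → Fin 4 → Fin 4 → Fin 4 → ℝ)
    {mixFF : Fin (d + 1) → (Fin (d + 1) → ℤ) → Fin (d + 1) → (Fin (d + 1) → ℤ) → MKer (d + 1) (Fib d)}
    (hmixt : ∀ (κ : Fin (d + 1)) (u : Fin (d + 1) → ℤ) (ρ : Fin (d + 1)) (w t : Fin (d + 1) → ℤ),
      mixFF κ (u + (Lc : ℤ) • t) ρ (w + t) = shiftK (-((Lc : ℤ) • t)) (mixFF κ u ρ w))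
    (n : ℕ) (κ : Fin (d + 1)) (u : Fin (d + 1) → ℤ) (κ' : Fin (d + 1)) (u' t : Fin (d + 1) → ℤ) :
    (fun κ u κ' u' =>
        unitS₂ (sfStep Lc (n + 1)) (smStep d Lc (n + 1)) (T2Of d Lc cE cVH cΛ cE₂ cB Tc (vh₂S d Lc) mixFF (n + 1)) κ u κ' u'
          - unitS₂ (sfStep Lc n) (smStep d Lc n) (T2Of d Lc cE cVH cΛ cE₂ cB Tc (vh₂S d Lc) mixFF n) κ u κ' u')
        κ (u + (Lc : ℤ) • t) κ' (u' + (Lc : ℤ) • t)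
      = shiftK (-((Lc : ℤ) • t))
          ((fun κ u κ' u' =>
            unitS₂ (sfStep Lc (n + 1)) (smStep d Lc (n + 1)) (T2Of d Lc cE cVH cΛ cE₂ cB Tc (vh₂S d Lc) mixFF (n + 1)) κ u κ' u'
              - unitS₂ (sfStep Lc n) (smStep d Lc n) (T2Of d Lc cE cVH cΛ cE₂ cB Tc (vh₂S d Lc) mixFF n) κ u κ' u') κ u κ' u') :=
  sub_translate (w := (Lc : ℤ) • t) (v := -((Lc : ℤ) • t))
    (fun κ u κ' u' => unitS₂_T2Of_translate hLc cE cVH cΛ cE₂ cB Tc hmixt (n + 1) κ u κ' u' t)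
    (fun κ u κ' u' => unitS₂_T2Of_translate hLc cE cVH cΛ cE₂ cB Tc hmixt n κ u κ' u' t) κ u κ' u'

/-- **JOINT BLOCK COVARIANCE OF THE CAUCHY DIFFERENCES `T♮_{k+j} − T♮_k`** [folklore] (the «T2Drift» tables of `WSlotT2OfPieces.cauchy_of_rate` ∕
leaf-07's Cauchy plug), lambda form. -/
theorem T2cauchy_translate (hLc : 1 ≤ Lc) (cE cVH cΛ cE₂ cB : ℝ) (Tc : Fin 4 → Fin 4 → Fin 4 → Fin 4 → ℝ)
    {mixFF : Fin (d + 1) → (Fin (d + 1) → ℤ) → Fin (d + 1) → (Fin (d + 1) → ℤ) → MKer (d + 1) (Fib d)}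
    (hmixt : ∀ (κ : Fin (d + 1)) (u : Fin (d + 1) → ℤ) (ρ : Fin (d + 1)) (w t : Fin (d + 1) → ℤ),
      mixFF κ (u + (Lc : ℤ) • t) ρ (w + t) = shiftK (-((Lc : ℤ) • t)) (mixFF κ u ρ w))
    (k j : ℕ) (κ : Fin (d + 1)) (u : Fin (d + 1) → ℤ) (κ' : Fin (d + 1)) (u' t : Fin (d + 1) → ℤ) :
    (fun κ u κ' u' =>
        unitS₂ (sfStep Lc (k + j)) (smStep d Lc (k + j)) (T2Of d Lc cE cVH cΛ cE₂ cB Tc (vh₂S d Lc) mixFF (k + j)) κ u κ' u'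
          - unitS₂ (sfStep Lc k) (smStep d Lc k) (T2Of d Lc cE cVH cΛ cE₂ cB Tc (vh₂S d Lc) mixFF k) κ u κ' u')
        κ (u + (Lc : ℤ) • t) κ' (u' + (Lc : ℤ) • t)
      = shiftK (-((Lc : ℤ) • t))
          ((fun κ u κ' u' =>
            unitS₂ (sfStep Lc (k + j)) (smStep d Lc (k + j)) (T2Of d Lc cE cVH cΛ cE₂ cB Tc (vh₂S d Lc) mixFF (k + j)) κ u κ' u'
              - unitS₂ (sfStep Lc k) (smStep d Lc k) (T2Of d Lc cE cVH cΛ cE₂ cB Tc (vh₂S d Lc) mixFF k) κ u κ' u') κ u κ' u') :=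
  sub_translate (w := (Lc : ℤ) • t) (v := -((Lc : ℤ) • t))
    (fun κ u κ' u' => unitS₂_T2Of_translate hLc cE cVH cΛ cE₂ cB Tc hmixt (k + j) κ u κ' u' t)
    (fun κ u κ' u' => unitS₂_T2Of_translate hLc cE cVH cΛ cE₂ cB Tc hmixt k κ u κ' u' t) κ u κ' u'

end StageB

/-! ## §3 (v1.1) The same at a GENERIC border table ∕ a GENERIC root of an1's averaging jet (ref2 r53 (w9): the ENDs' `vh₂S` becomes a
parameter with a covariance binder `hBt`; an1's `vh₂SAt_translate` discharges it at every root `ρ`, `mixFFAt_translate` discharges `hmixt` —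
leaf-11-g18 l.8907) -/

section GenericRoot

open AveragingMixedJetTables (vh₂SAt vh₂SAt_translate mixFFAt mixFFAt_translate)

variable {Lc : ℕ} [NeZero Lc]

/-- **JOINT BLOCK COVARIANCE OF THE NORMALISED FAMILY OVER ANY BORDER TABLE `B`** [folklore instantiation]: an2's `T2Of_translate` with BOTH its
binders displayed — `hBt` (border bi-table jointly `Lc`-covariant) and `hmixt` (mixed table) — transported through `unitS₂_translate`.  The base-root
`unitS₂_T2Of_translate` is the instance `B := vh₂S d Lc`, `hBt := vh₂S_translate hLc`. -/
theorem unitS₂_T2Of_translate_of (hLc : 1 ≤ Lc) (cE cVH cΛ cE₂ cB : ℝ) (Tc : Fin 4 → Fin 4 → Fin 4 → Fin 4 → ℝ)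
    {B : Fin (d + 1) → (Fin (d + 1) → ℤ) → Fin (d + 1) → (Fin (d + 1) → ℤ) → MKer (d + 1) (Fib d)}
    (hBt : ∀ (κ : Fin (d + 1)) (u : Fin (d + 1) → ℤ) (κ' : Fin (d + 1)) (u' t : Fin (d + 1) → ℤ),
      B κ (u + (Lc : ℤ) • t) κ' (u' + (Lc : ℤ) • t) = shiftK (-((Lc : ℤ) • t)) (B κ u κ' u'))
    {mixFF : Fin (d + 1) → (Fin (d + 1) → ℤ) → Fin (d + 1) → (Fin (d + 1) → ℤ) → MKer (d + 1) (Fib d)}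
    (hmixt : ∀ (κ : Fin (d + 1)) (u : Fin (d + 1) → ℤ) (ρ : Fin (d + 1)) (w t : Fin (d + 1) → ℤ),
      mixFF κ (u + (Lc : ℤ) • t) ρ (w + t) = shiftK (-((Lc : ℤ) • t)) (mixFF κ u ρ w))
    (j : ℕ) (κ : Fin (d + 1)) (u : Fin (d + 1) → ℤ) (κ' : Fin (d + 1)) (u' t : Fin (d + 1) → ℤ) :
    unitS₂ (sfStep Lc j) (smStep d Lc j) (T2Of d Lc cE cVH cΛ cE₂ cB Tc B mixFF j) κ (u + (Lc : ℤ) • t) κ' (u' + (Lc : ℤ) • t)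
      = shiftK (-((Lc : ℤ) • t)) (unitS₂ (sfStep Lc j) (smStep d Lc j) (T2Of d Lc cE cVH cΛ cE₂ cB Tc B mixFF j) κ u κ' u') :=
  unitS₂_translate (w := (Lc : ℤ) • t) (v := -((Lc : ℤ) • t)) (sfStep Lc j) (smStep d Lc j)
    (fun κ u κ' u' => T2Of_translate hLc cE cVH cΛ cE₂ cB Tc hBt hmixt j κ u κ' u' t) κ u κ' u'

/-- **… AND OF ITS ONE-STEP DIFFERENCES `D n` over any border table** (lambda form). -/
theorem T2diff_translate_of (hLc : 1 ≤ Lc) (cE cVH cΛ cE₂ cB : ℝ) (Tc : Fin 4 → Fin 4 → Fin 4 → Fin 4 → ℝ)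
    {B : Fin (d + 1) → (Fin (d + 1) → ℤ) → Fin (d + 1) → (Fin (d + 1) → ℤ) → MKer (d + 1) (Fib d)}
    (hBt : ∀ (κ : Fin (d + 1)) (u : Fin (d + 1) → ℤ) (κ' : Fin (d + 1)) (u' t : Fin (d + 1) → ℤ),
      B κ (u + (Lc : ℤ) • t) κ' (u' + (Lc : ℤ) • t) = shiftK (-((Lc : ℤ) • t)) (B κ u κ' u'))
    {mixFF : Fin (d + 1) → (Fin (d + 1) → ℤ) → Fin (d + 1) → (Fin (d + 1) → ℤ) → MKer (d + 1) (Fib d)}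
    (hmixt : ∀ (κ : Fin (d + 1)) (u : Fin (d + 1) → ℤ) (ρ : Fin (d + 1)) (w t : Fin (d + 1) → ℤ),
      mixFF κ (u + (Lc : ℤ) • t) ρ (w + t) = shiftK (-((Lc : ℤ) • t)) (mixFF κ u ρ w))
    (n : ℕ) (κ : Fin (d + 1)) (u : Fin (d + 1) → ℤ) (κ' : Fin (d + 1)) (u' t : Fin (d + 1) → ℤ) :
    (fun κ u κ' u' =>
        unitS₂ (sfStep Lc (n + 1)) (smStep d Lc (n + 1)) (T2Of d Lc cE cVH cΛ cE₂ cB Tc B mixFF (n + 1)) κ u κ' u'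
          - unitS₂ (sfStep Lc n) (smStep d Lc n) (T2Of d Lc cE cVH cΛ cE₂ cB Tc B mixFF n) κ u κ' u')
        κ (u + (Lc : ℤ) • t) κ' (u' + (Lc : ℤ) • t)
      = shiftK (-((Lc : ℤ) • t))
          ((fun κ u κ' u' =>
            unitS₂ (sfStep Lc (n + 1)) (smStep d Lc (n + 1)) (T2Of d Lc cE cVH cΛ cE₂ cB Tc B mixFF (n + 1)) κ u κ' u'
              - unitS₂ (sfStep Lc n) (smStep d Lc n) (T2Of d Lc cE cVH cΛ cE₂ cB Tc B mixFF n) κ u κ' u') κ u κ' u') :=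
  sub_translate (w := (Lc : ℤ) • t) (v := -((Lc : ℤ) • t))
    (fun κ u κ' u' => unitS₂_T2Of_translate_of hLc cE cVH cΛ cE₂ cB Tc hBt hmixt (n + 1) κ u κ' u' t)
    (fun κ u κ' u' => unitS₂_T2Of_translate_of hLc cE cVH cΛ cE₂ cB Tc hBt hmixt n κ u κ' u' t) κ u κ' u'

/-- **… AND OF ITS CAUCHY DIFFERENCES `T♮_{k+j} − T♮_k` over any border table** (lambda form). -/
theorem T2cauchy_translate_of (hLc : 1 ≤ Lc) (cE cVH cΛ cE₂ cB : ℝ) (Tc : Fin 4 → Fin 4 → Fin 4 → Fin 4 → ℝ)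
    {B : Fin (d + 1) → (Fin (d + 1) → ℤ) → Fin (d + 1) → (Fin (d + 1) → ℤ) → MKer (d + 1) (Fib d)}
    (hBt : ∀ (κ : Fin (d + 1)) (u : Fin (d + 1) → ℤ) (κ' : Fin (d + 1)) (u' t : Fin (d + 1) → ℤ),
      B κ (u + (Lc : ℤ) • t) κ' (u' + (Lc : ℤ) • t) = shiftK (-((Lc : ℤ) • t)) (B κ u κ' u'))
    {mixFF : Fin (d + 1) → (Fin (d + 1) → ℤ) → Fin (d + 1) → (Fin (d + 1) → ℤ) → MKer (d + 1) (Fib d)}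
    (hmixt : ∀ (κ : Fin (d + 1)) (u : Fin (d + 1) → ℤ) (ρ : Fin (d + 1)) (w t : Fin (d + 1) → ℤ),
      mixFF κ (u + (Lc : ℤ) • t) ρ (w + t) = shiftK (-((Lc : ℤ) • t)) (mixFF κ u ρ w))
    (k j : ℕ) (κ : Fin (d + 1)) (u : Fin (d + 1) → ℤ) (κ' : Fin (d + 1)) (u' t : Fin (d + 1) → ℤ) :
    (fun κ u κ' u' =>
        unitS₂ (sfStep Lc (k + j)) (smStep d Lc (k + j)) (T2Of d Lc cE cVH cΛ cE₂ cB Tc B mixFF (k + j)) κ u κ' u'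
          - unitS₂ (sfStep Lc k) (smStep d Lc k) (T2Of d Lc cE cVH cΛ cE₂ cB Tc B mixFF k) κ u κ' u')
        κ (u + (Lc : ℤ) • t) κ' (u' + (Lc : ℤ) • t)
      = shiftK (-((Lc : ℤ) • t))
          ((fun κ u κ' u' =>
            unitS₂ (sfStep Lc (k + j)) (smStep d Lc (k + j)) (T2Of d Lc cE cVH cΛ cE₂ cB Tc B mixFF (k + j)) κ u κ' u'
              - unitS₂ (sfStep Lc k) (smStep d Lc k) (T2Of d Lc cE cVH cΛ cE₂ cB Tc B mixFF k) κ u κ' u') κ u κ' u') :=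
  sub_translate (w := (Lc : ℤ) • t) (v := -((Lc : ℤ) • t))
    (fun κ u κ' u' => unitS₂_T2Of_translate_of hLc cE cVH cΛ cE₂ cB Tc hBt hmixt (k + j) κ u κ' u' t)
    (fun κ u κ' u' => unitS₂_T2Of_translate_of hLc cE cVH cΛ cE₂ cB Tc hBt hmixt k κ u κ' u' t) κ u κ' u'

/-- **AT ANY ROOT `ρ` OF an1's AVERAGING JET** [folklore instantiation]: with the border table `vh₂SAt ρ Lc` (an1's `vh₂SAt_translate hLc ρ` discharges
`hBt`; `vh₂S d Lc` is the root `ρ = 0`) every normalised member is jointly `Lc`-covariant; `hmixt` stays the one binder (for an1's `mixFFAt ρ′ Lc` it is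
`mixFFAt_translate ρ′ Lc` BY NAME). -/
theorem unitS₂_T2Of_translate_at (hLc : 1 ≤ Lc) (cE cVH cΛ cE₂ cB : ℝ) (Tc : Fin 4 → Fin 4 → Fin 4 → Fin 4 → ℝ)
    (ρ : Fin (d + 1) → ℤ)
    {mixFF : Fin (d + 1) → (Fin (d + 1) → ℤ) → Fin (d + 1) → (Fin (d + 1) → ℤ) → MKer (d + 1) (Fib d)}
    (hmixt : ∀ (κ : Fin (d + 1)) (u : Fin (d + 1) → ℤ) (ρ : Fin (d + 1)) (w t : Fin (d + 1) → ℤ),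
      mixFF κ (u + (Lc : ℤ) • t) ρ (w + t) = shiftK (-((Lc : ℤ) • t)) (mixFF κ u ρ w))
    (j : ℕ) (κ : Fin (d + 1)) (u : Fin (d + 1) → ℤ) (κ' : Fin (d + 1)) (u' t : Fin (d + 1) → ℤ) :
    unitS₂ (sfStep Lc j) (smStep d Lc j) (T2Of d Lc cE cVH cΛ cE₂ cB Tc (vh₂SAt ρ Lc) mixFF j) κ (u + (Lc : ℤ) • t) κ' (u' + (Lc : ℤ) • t)
      = shiftK (-((Lc : ℤ) • t))
          (unitS₂ (sfStep Lc j) (smStep d Lc j) (T2Of d Lc cE cVH cΛ cE₂ cB Tc (vh₂SAt ρ Lc) mixFF j) κ u κ' u') :=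
  unitS₂_T2Of_translate_of hLc cE cVH cΛ cE₂ cB Tc (fun κ u κ' u' t => vh₂SAt_translate hLc ρ κ u κ' u' t) hmixt j κ u κ' u' t

/-- **an1's TABLES OF RECORD, NO BINDER LEFT** [folklore instantiation]: border `vh₂SAt ρ Lc`, mixed table `mixFFAt ρ′ Lc` (an1's
`mixFFAt_translate` BY NAME) — every normalised member is jointly `Lc`-covariant, unconditionally. -/
theorem unitS₂_T2Of_translate_an1 (hLc : 1 ≤ Lc) (cE cVH cΛ cE₂ cB : ℝ) (Tc : Fin 4 → Fin 4 → Fin 4 → Fin 4 → ℝ)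
    (ρ ρ' : Fin (d + 1) → ℤ) (j : ℕ) (κ : Fin (d + 1)) (u : Fin (d + 1) → ℤ) (κ' : Fin (d + 1)) (u' t : Fin (d + 1) → ℤ) :
    unitS₂ (sfStep Lc j) (smStep d Lc j) (T2Of d Lc cE cVH cΛ cE₂ cB Tc (vh₂SAt ρ Lc) (mixFFAt ρ' Lc) j) κ (u + (Lc : ℤ) • t)
        κ' (u' + (Lc : ℤ) • t)
      = shiftK (-((Lc : ℤ) • t))
          (unitS₂ (sfStep Lc j) (smStep d Lc j) (T2Of d Lc cE cVH cΛ cE₂ cB Tc (vh₂SAt ρ Lc) (mixFFAt ρ' Lc) j) κ u κ' u') :=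
  unitS₂_T2Of_translate_at hLc cE cVH cΛ cE₂ cB Tc ρ (fun κ u μ y t => mixFFAt_translate ρ' Lc κ u μ y t) j κ u κ' u' t

end GenericRoot

end Summit.QuantumFields.BalabanUV.Beta.GAN24.T2SlotCovariance

end
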